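import Summits.NavierStokesRegularity.NavierStokesRegularity.Theorems.HardyPointSinkHardyAncientLimitTypeI
import Summits.NavierStokesRegularity.NavierStokesRegularity.Theorems.HardyPointSinkHardyAncientLimitAssemblyA
import Summits.NavierStokesRegularity.NavierStokesRegularity.Theorems.HardyPointSinkHardyAncientLimitCompactness
import Summits.NavierStokesRegularity.NavierStokesRegularity.Theorems.HardyPointSinkHardyAncientLimitTransport
import Summits.NavierStokesRegularity.NavierStokesRegularity.Theorems.HardyPointSinkHardyAncientLimitMild
import Summits.NavierStokesRegularity.NavierStokesRegularity.Theorems.HardyPointSinkHardyAncientLimitClassical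
import HarnessLib

/-!
# Route HardyPointSink — `HardyAncientLimit`, step 9b: the ancient limit in the zoomed frame

Support file for item stmt-NavierStokesRegularity-9138 (`HardyAncientLimit`) of route
`HardyPointSink` (problem `NavierStokesRegularity`).

`HardyAncientLimit.exists_ancient_of_zoomed`: let `(u₁, p₁)` be classical on `]-1, 0[ × ℝ³`,
continuous on `Q(1)` and not essentially bounded near the origin, with Albritton–Barker's Type I
quantity of `Q(0, 1/2)` finite (computed with a gauged pressure `p₁ - g(t)` and the classical
gradient), and with the Hardy energies about all centres of `B(0, R₀)`, `R₀ ≥ 1`, bounded by `K`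
on `]-1, 0[`. Then the blow-up about the near-maximum points of Seregin–Šverák 2009, §4
(`exists_blowup_sequence`, `exists_blowup_limit`) produces a bounded, non-trivial, classical
ancient solution `(W, P)` on `]-∞, 0[ × ℝ³` with `𝐈 < ∞` and Hardy energies bounded by the same
`K`: the Hardy bound is scale invariant and passes to the pointwise limit by Fatou
(`lintegral_hardy_le_of_tendsto`), it gives the Morrey growth that upgrades the bounded weak
limit to an Oseen-mild (`oseenMild_of_boundedWeak_ancient`), hence smooth and classical
(`exists_isClassicalNSSolutionOn_Iio_of_oseen`) solution; `A ≤ K` from the Hardy bound,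
`C, E ≤ 𝐈₀` by Fatou along the blow-up (`cknC_limit_le`, `cknE_limit_le`), and `D ≤ 𝐈₀` by the
weak `L^{3/2}` pressure argument (`cknDOsc_limit_le`). This is the forward direction of
Albritton–Barker 2019, Thm. 1.1, with the Hardy bound transported along.

## References

* D. Albritton, T. Barker, arXiv:1811.00502, Thm. 1.1, §3.
* G. Seregin, V. Šverák, Comm. PDE 34 (2009), §4.
* G. Koch, N. Nadirashvili, G. Seregin, V. Šverák, Acta Math. 203 (2009), §5–6.
-/

noncomputable section

open Literature.Analysis.FluidPDE Literature.Analysis.FluidPDE.SereginSverak2009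
open MeasureTheory Set Function Filter Topology Metric TopologicalSpace
open scoped ENNReal NNReal

namespace Summit.NavierStokesRegularity.NavierStokesRegularity.Theorems

namespace HardyAncientLimit

/-- A parabolic ball `Q(z, r)`, `r > 0`, below `{t < 0} × ℝ³` has `z.1 ≤ 0`. [folklore] -/
theorem fst_nonpos_of_parabolicCylinder_subset {r : ℝ} (hr : 0 < r)
    {z : ℝ × EuclideanSpace ℝ (Fin 3)}
    (h : parabolicCylinder r z ⊆ Iio (0 : ℝ) ×ˢ (univ : Set (EuclideanSpace ℝ (Fin 3)))) :
    z.1 ≤ 0 := by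
  by_contra hz
  rw [not_le] at hz
  set t : ℝ := max (z.1 - r ^ 2 / 2) (z.1 / 2) with ht
  have hw : ((t, z.2) : ℝ × EuclideanSpace ℝ (Fin 3)) ∈ parabolicCylinder r z := by
    refine ⟨⟨?_, ?_⟩, mem_ball_self hr⟩
    · exact lt_of_lt_of_le (by nlinarith [sq_nonneg r, hr]) (le_max_left _ _)
    · exact max_lt (by nlinarith [sq_nonneg r, hr]) (by linarith)
  have h0 : t < 0 := (h hw).1
  have : z.1 / 2 ≤ t := le_max_right _ _
  linarith

/-- **The Hardy bound passes to the blow-up limit.** Along the blow-up `U_k = c_k u₁ ∘ Φ_k`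
about centres `z_k ∈ Q(1/8)` with scales `c_k ≤ 1/(20(k+1))`, if the Hardy energies of `u₁`
about the centres of `B(0, R₀)`, `R₀ ≥ 1`, are bounded by `K` on `]-1, 0[`, then every pointwise
limit `W(s, ·) = lim U_{φ(j)}(s, ·)`, `s ≤ 0`, has Hardy energies `≤ K` about every centre (the
Hardy energy is invariant under the Navier–Stokes scaling; Fatou). [cite: AlbrittonBarker2019, §3] -/
theorem hardy_limit_le
    {u₁ : ℝ → EuclideanSpace ℝ (Fin 3) → EuclideanSpace ℝ (Fin 3)}
    {p₁ : ℝ → EuclideanSpace ℝ (Fin 3) → ℝ}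
    (hcl₁ : IsClassicalNSSolutionOn (Ioo (-1 : ℝ) 0) 1 0 u₁ p₁)
    {zc : ℕ → ℝ × EuclideanSpace ℝ (Fin 3)} {c : ℕ → ℝ}
    (hzc : ∀ k, zc k ∈ parCyl (0 : ℝ × EuclideanSpace ℝ (Fin 3)) (1 / 8)) (hc0 : ∀ k, 0 < c k)
    (hc1 : ∀ k : ℕ, c k ≤ 1 / (20 * ((k : ℝ) + 1)))
    {K : ℝ≥0} {R₀ : ℝ} (hR₀ : 1 ≤ R₀)
    (hH₁ : ∀ x₀ ∈ ball (0 : EuclideanSpace ℝ (Fin 3)) R₀, ∀ t ∈ Ioo (-1 : ℝ) 0,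
      ∫⁻ x in ball (0 : EuclideanSpace ℝ (Fin 3)) R₀, ‖u₁ t x‖ₑ ^ 2 / ‖x - x₀‖ₑ ≤ K)
    {φ : ℕ → ℕ} (hφ : StrictMono φ) {W : ℝ × EuclideanSpace ℝ (Fin 3) → EuclideanSpace ℝ (Fin 3)}
    (hpt : ∀ z : ℝ × EuclideanSpace ℝ (Fin 3), z.1 ≤ 0 →
      Tendsto (fun j => uncurry (c (φ j) • stPull (c (φ j) ^ 2) (c (φ j)) (zc (φ j)).1
        (zc (φ j)).2 u₁) z) atTop (𝓝 (W z)))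
    {s : ℝ} (hs : s ≤ 0) (y₀ : EuclideanSpace ℝ (Fin 3)) :
    ∫⁻ y, ‖W (s, y)‖ₑ ^ 2 / ‖y - y₀‖ₑ ≤ K := by
  set U : ℕ → ℝ → EuclideanSpace ℝ (Fin 3) → EuclideanSpace ℝ (Fin 3) := fun k =>
    c k • stPull (c k ^ 2) (c k) (zc k).1 (zc k).2 u₁ with hUdef
  have hU : ∀ k, U k = c k • stPull (c k ^ 2) (c k) (zc k).1 (zc k).2 u₁ := fun k => rfl
  -- geometry of the centres
  have hzc2 : ∀ k, ‖(zc k).2‖ < 1 / 4 := fun k => by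
    have h1 := (mem_parCyl_zero.1 (hzc k)).2
    have h2 : (zc k).2 ∈ ball (0 : EuclideanSpace ℝ (Fin 3)) (2 * (1 / 8)) :=
      spaceCyl_zero_subset_ball (1 / 8) ((mem_spaceCyl).2 (by simpa using h1))
    rw [mem_ball_zero_iff] at h2
    linarith
  -- a tail on which the slices are smooth
  obtain ⟨j₀, hj₀⟩ := eventually_atTop.1 (hφ.tendsto_atTop.eventually
    (eventually_contDiff_slice hcl₁.smooth_velocity hU hzc hc0 hc1 hs))
  set F : ℕ → EuclideanSpace ℝ (Fin 3) → EuclideanSpace ℝ (Fin 3) := fun j => U (φ (j + j₀)) s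
    with hF
  have hmeas : ∀ j, AEStronglyMeasurable (F j) volume := fun j =>
    (hj₀ (j + j₀) (Nat.le_add_left _ _)).1.continuous.aestronglyMeasurable
  have hlim : ∀ y, Tendsto (fun j => F j y) atTop (𝓝 (W (s, y))) := fun y =>
    (hpt (s, y) hs).comp (tendsto_add_atTop_nat j₀)
  -- the exhausting balls `B_j`, images of `B(0, R₀)`
  set ctr : ℕ → EuclideanSpace ℝ (Fin 3) := fun k => -(c k)⁻¹ • (zc k).2 with hctr
  set B : ℕ → Set (EuclideanSpace ℝ (Fin 3)) := fun j =>
    ball (ctr (φ (j + j₀))) (R₀ / c (φ (j + j₀))) with hB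
  have hctr0 : ∀ k, (zc k).2 + c k • ctr k = 0 := fun k => by
    show (zc k).2 + c k • (-(c k)⁻¹ • (zc k).2) = 0
    rw [smul_smul, mul_neg, mul_inv_cancel₀ (hc0 k).ne', neg_one_smul, add_neg_cancel]
  have hexh : ∀ y, ∀ᶠ j in atTop, y ∈ B j := by
    intro y
    have hev : ∀ᶠ j in atTop, c (φ (j + j₀)) * ‖y‖ ≤ 1 / 2 :=
      (hφ.tendsto_atTop.comp (tendsto_add_atTop_nat j₀)).eventually
        (eventually_scale_mul_le hc0 hc1 ‖y‖ one_half_pos)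
    filter_upwards [hev] with j hj
    set k := φ (j + j₀)
    have hck : 0 < c k := hc0 k
    rw [hB, mem_ball, dist_eq_norm]
    have h1 : ‖y - ctr k‖ ≤ ‖y‖ + (c k)⁻¹ * ‖(zc k).2‖ := by
      calc ‖y - ctr k‖ ≤ ‖y‖ + ‖ctr k‖ := norm_sub_le _ _
        _ = ‖y‖ + (c k)⁻¹ * ‖(zc k).2‖ := by
            rw [hctr]
            simp only [norm_neg, norm_smul, Real.norm_eq_abs, abs_of_pos (inv_pos.2 hck)]
    have h2 : ‖y‖ + (c k)⁻¹ * ‖(zc k).2‖ < R₀ / c k := by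
      rw [lt_div_iff₀ hck]
      have e : (‖y‖ + (c k)⁻¹ * ‖(zc k).2‖) * c k = c k * ‖y‖ + ‖(zc k).2‖ := by
        field_simp
      rw [e]
      linarith [hzc2 k]
    exact h1.trans_lt h2
  have hbound : ∀ᶠ j in atTop, ∫⁻ y in B j, ‖F j y‖ₑ ^ 2 / ‖y - y₀‖ₑ ≤ K := by
    have hev1 : ∀ᶠ j in atTop, c (φ (j + j₀)) * ‖y₀‖ ≤ 1 / 2 :=
      (hφ.tendsto_atTop.comp (tendsto_add_atTop_nat j₀)).eventually
        (eventually_scale_mul_le hc0 hc1 ‖y₀‖ one_half_pos)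
    have hev2 : ∀ᶠ j in atTop, ∀ σ ∈ Icc (-|s|) 0,
        (zc (φ (j + j₀))).1 + c (φ (j + j₀)) ^ 2 * σ ∈ Ioo (-1 : ℝ) 0 :=
      (hφ.tendsto_atTop.comp (tendsto_add_atTop_nat j₀)).eventually
        (eventually_time_mem_Ioo hzc hc0 hc1 |s|)
    filter_upwards [hev1, hev2] with j hj1 hj2
    set k := φ (j + j₀)
    have hck : 0 < c k := hc0 k
    have ht : (zc k).1 + c k ^ 2 * s ∈ Ioo (-1 : ℝ) 0 := hj2 s ⟨neg_abs_le s, hs⟩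
    have hx₀ : (zc k).2 + c k • y₀ ∈ ball (0 : EuclideanSpace ℝ (Fin 3)) R₀ := by
      rw [mem_ball_zero_iff]
      calc ‖(zc k).2 + c k • y₀‖ ≤ ‖(zc k).2‖ + c k * ‖y₀‖ := by
            refine (norm_add_le _ _).trans ?_
            rw [norm_smul, Real.norm_eq_abs, abs_of_pos hck]
        _ < 1 := by linarith [hzc2 k]
        _ ≤ R₀ := hR₀
    show ∫⁻ y in ball (ctr k) (R₀ / c k), ‖U k s y‖ₑ ^ 2 / ‖y - y₀‖ₑ ≤ K
    rw [hU k, lintegral_hardy_zoom hck, hctr0 k, mul_div_cancel₀ _ hck.ne']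
    exact hH₁ _ hx₀ _ ht
  exact lintegral_hardy_le_of_tendsto hmeas hlim (fun j => measurableSet_ball) hexh hbound

/-- **The ancient limit in the zoomed frame** (Albritton–Barker 2019, Thm. 1.1, forward
direction, with the Hardy bound transported). See the module docstring.
[cite: AlbrittonBarker2019, Thm. 1.1 and §3] -/
theorem exists_ancient_of_zoomed
    {u₁ : ℝ → EuclideanSpace ℝ (Fin 3) → EuclideanSpace ℝ (Fin 3)}
    {p₁ : ℝ → EuclideanSpace ℝ (Fin 3) → ℝ} {g : ℝ → ℝ} {K : ℝ≥0} {R₀ : ℝ}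
    (hcl₁ : IsClassicalNSSolutionOn (Ioo (-1 : ℝ) 0) 1 0 u₁ p₁)
    (hsing₁ : ¬ IsRegularAtOrigin u₁)
    (hI : typeIBound (parabolicCylinder (1 / 2) (0 : ℝ × EuclideanSpace ℝ (Fin 3))) u₁
      (fun t x => p₁ t x - g t) (fun s y => fderiv ℝ (u₁ s) y) < ⊤)
    (hR₀ : 1 ≤ R₀)
    (hH₁ : ∀ x₀ ∈ ball (0 : EuclideanSpace ℝ (Fin 3)) R₀, ∀ t ∈ Ioo (-1 : ℝ) 0,
      ∫⁻ x in ball (0 : EuclideanSpace ℝ (Fin 3)) R₀, ‖u₁ t x‖ₑ ^ 2 / ‖x - x₀‖ₑ ≤ K) :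
    ∃ (U : ℝ → EuclideanSpace ℝ (Fin 3) → EuclideanSpace ℝ (Fin 3))
      (P : ℝ → EuclideanSpace ℝ (Fin 3) → ℝ),
      IsClassicalNSSolutionOn (Iio 0) 1 0 U P ∧
      (∃ M : ℝ, ∀ t < 0, ∀ x : EuclideanSpace ℝ (Fin 3), ‖U t x‖ ≤ M) ∧
      (∃ t < 0, ∃ x : EuclideanSpace ℝ (Fin 3), U t x ≠ 0) ∧
      (⨆ (r : ℝ) (_ : 0 < r) (z : ℝ × EuclideanSpace ℝ (Fin 3))
          (_ : parabolicCylinder r z ⊆ Iio (0 : ℝ) ×ˢ (univ : Set (EuclideanSpace ℝ (Fin 3)))),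
        cknA r z U + cknC r z U +
          (ENNReal.ofReal r ^ 2)⁻¹ * (∫⁻ w in parabolicCylinder r z,
            ‖P w.1 w.2 - ⨍ y in ball z.2 r, P w.1 y‖ₑ ^ (3 / 2 : ℝ)) +
          cknE r z (fun t x => fderiv ℝ (U t) x)) < ⊤ ∧
      (∃ K : NNReal, ∀ x₀ : EuclideanSpace ℝ (Fin 3), ∀ t < 0,
        ∫⁻ x, ‖U t x‖ₑ ^ 2 / ‖x - x₀‖ₑ ≤ K) := by
  -- continuity on `Q(1)`
  have hcont₁ : ContinuousOn (uncurry u₁) (parCyl 0 1) := by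
    refine hcl₁.smooth_velocity.continuousOn.mono fun z hz => ⟨?_, mem_univ _⟩
    have h := (mem_parCyl_zero.1 hz).1
    exact ⟨by linarith [h.1], h.2⟩
  -- the blow-up sequence
  obtain ⟨zc, c, hzc, hc0, hc1, hcM, hcontU, hbU⟩ := exists_blowup_sequence hcont₁ hsing₁
  set U : ℕ → ℝ → EuclideanSpace ℝ (Fin 3) → EuclideanSpace ℝ (Fin 3) := fun k =>
    c k • stPull (c k ^ 2) (c k) (zc k).1 (zc k).2 u₁ with hUdef
  have hU : ∀ k, U k = c k • stPull (c k ^ 2) (c k) (zc k).1 (zc k).2 u₁ := fun k => rfl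
  set Pq : ℕ → ℝ → EuclideanSpace ℝ (Fin 3) → ℝ := fun k =>
    c k ^ 2 • stPull (c k ^ 2) (c k) (zc k).1 (zc k).2 (fun t x => p₁ (max t (-(1 / 2))) x)
    with hPqdef
  have hPc : ∀ k, ContinuousOn (uncurry (Pq k)) (Iic 0 ×ˢ univ) := fun k =>
    continuousOn_clampedPressure hcl₁ hzc k
  have hNSR : ∀ a : ℝ, 0 < a → ∀ᶠ k in atTop,
      IsDistributionalNSSolutionOn (parCylOpens 0 a) 1 0 (U k) (Pq k) := fun a _ =>
    eventually_isDistributional_clamped hcl₁ hzc hc0 hc1 a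
  -- the Type I bound and its components
  set I₀ : ℝ≥0∞ := typeIBound (parabolicCylinder (1 / 2) (0 : ℝ × EuclideanSpace ℝ (Fin 3))) u₁
    (fun t x => p₁ t x - g t) (fun s y => fderiv ℝ (u₁ s) y) with hI₀
  have hI0 : I₀ ≠ ⊤ := hI.ne
  have hcomp : ∀ ρ : ℝ, 0 < ρ → ∀ z' : ℝ × EuclideanSpace ℝ (Fin 3),
      parabolicCylinder ρ z' ⊆ parabolicCylinder (1 / 2) (0 : ℝ × EuclideanSpace ℝ (Fin 3)) →
        cknC ρ z' u₁ ≤ I₀ ∧ cknDOsc ρ z' (fun t x => p₁ t x - g t) ≤ I₀ ∧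
          cknE ρ z' (fun t x => fderiv ℝ (u₁ t) x) ≤ I₀ := by
    intro ρ hρ z' hz'
    have h := abScaledSum_le_typeIBound (u := u₁) (p := fun t x => p₁ t x - g t)
      (G := fun s y => fderiv ℝ (u₁ s) y) hρ hz'
    unfold abScaledSum at h
    exact ⟨(le_add_self.trans (le_self_add.trans le_self_add)).trans h,
      (le_add_self.trans le_self_add).trans h, le_add_self.trans h⟩
  have hD : ∀ r : ℝ, 0 < r → ∀ z : ℝ × EuclideanSpace ℝ (Fin 3), z.1 ≤ 0 →
      ∀ᶠ k in atTop, cknDOsc r z (Pq k) ≤ I₀ := fun r hr z hz =>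
    eventually_cknDOsc_clamped_le hcl₁ hzc hc0 hc1 (fun ρ hρ z' hz' => (hcomp ρ hρ z' hz').2.1) hr hz
  have hNS' := exists_pressure_bound hPc hNSR hD hI0
  -- the blow-up limit
  obtain ⟨φ, W, hφ, hWc, hWb, hunifT, hpt, hbw⟩ := exists_blowup_limit U hcontU hbU hNS'
  set w : ℝ → EuclideanSpace ℝ (Fin 3) → EuclideanSpace ℝ (Fin 3) := fun t x => W (t, x) with hw
  have hwW : uncurry w = W := by
    funext z
    rfl
  -- Hardy for the limit
  have hHW : ∀ s ≤ (0 : ℝ), ∀ y₀ : EuclideanSpace ℝ (Fin 3),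
      ∫⁻ y, ‖W (s, y)‖ₑ ^ 2 / ‖y - y₀‖ₑ ≤ K := fun s hs y₀ =>
    hardy_limit_le hcl₁ hzc hc0 hc1 hR₀ hH₁ hφ hpt hs y₀
  -- bounded weak ⇒ Oseen-mild ⇒ classical
  have hwcont : ContinuousOn (uncurry w) (Iio 0 ×ˢ univ) := by
    rw [hwW]
    exact hWc.mono (prod_mono Iio_subset_Iic_self le_rfl)
  have hM : ∀ t < 0, ∀ x, ‖w t x‖ ≤ 1 := fun t ht x => hWb (t, x) ht.le
  have hMor : ∀ t < 0, ∀ m : ℕ, 1 ≤ m →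
      ∫⁻ y in ball (0 : EuclideanSpace ℝ (Fin 3)) m, ‖w t y‖ₑ ^ 2 ≤
        ENNReal.ofReal ((K : ℝ) * m) := by
    intro t ht m hm
    have hm0 : (0 : ℝ) < (m : ℝ) := by exact_mod_cast hm
    have h := lintegral_ball_sq_le_of_hardy (g := fun y => w t y) (by simpa using hHW t ht.le 0) hm0
    rw [ENNReal.ofReal_mul K.coe_nonneg, ENNReal.ofReal_coe_nnreal]
    exact h
  obtain ⟨hdiv, hmild⟩ := oseenMild_of_boundedWeak_ancient hbw hwcont hM K.coe_nonneg hMor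
  have hanc := (isBoundedAncientMildSolution_of_oseen hwcont zero_le_one hM hdiv hmild).1
  obtain ⟨P, hclP⟩ := exists_isClassicalNSSolutionOn_Iio_of_oseen hwcont zero_le_one hM hanc hmild
  -- the normalisation `|U_k(0, 0)| = 1/2` and its limit
  have hnorm : ∀ k, ‖uncurry (U k) (0, 0)‖ = 1 / 2 := fun k => by
    simp only [hU, uncurry_apply_pair, Pi.smul_apply, stPull_apply, mul_zero, add_zero, smul_zero,
      norm_smul, Real.norm_eq_abs, abs_of_pos (hc0 k)]
    exact hcM k
  have hW0 : ‖W (0, 0)‖ = 1 / 2 := by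
    have h1 := (continuous_norm.tendsto _).comp (hpt (0, 0) le_rfl)
    have h2 : Tendsto (fun j => ‖uncurry (U (φ j)) (0, 0)‖) atTop (𝓝 (1 / 2)) := by
      simp only [hnorm]
      exact tendsto_const_nhds
    exact tendsto_nhds_unique h1 h2
  refine ⟨w, P, hclP, ⟨1, hM⟩, ?_, ?_, ⟨K, fun x₀ t ht => hHW t ht.le x₀⟩⟩
  · -- non-triviality near the top
    have hι : ContinuousWithinAt (W ∘ fun t : ℝ => ((t, 0) : ℝ × EuclideanSpace ℝ (Fin 3)))
        (Iic 0) 0 :=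
      (hWc.comp (continuous_id.prodMk continuous_const).continuousOn
        fun t ht => ⟨ht, mem_univ _⟩) 0 (le_refl (0 : ℝ))
    have h14 : (1 / 4 : ℝ) < ‖W (0, 0)‖ := by rw [hW0]; norm_num
    have hev : ∀ᶠ t in 𝓝[Iic (0 : ℝ)] 0, (1 / 4 : ℝ) < ‖W (t, 0)‖ :=
      hι.eventually ((isOpen_lt continuous_const continuous_norm).mem_nhds
        (show (W ∘ fun t : ℝ => ((t, 0) : ℝ × EuclideanSpace ℝ (Fin 3))) 0 ∈
          {v : EuclideanSpace ℝ (Fin 3) | (1 / 4 : ℝ) < ‖v‖} from h14))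
    have hev' : ∀ᶠ t in 𝓝[Iio (0 : ℝ)] 0, (1 / 4 : ℝ) < ‖W (t, 0)‖ :=
      hev.filter_mono (nhdsWithin_mono _ Iio_subset_Iic_self)
    obtain ⟨t, ht, ht0⟩ := (hev'.and self_mem_nhdsWithin).exists
    refine ⟨t, ht0, 0, fun h0 => ?_⟩
    have : ‖W (t, 0)‖ = 0 := by
      rw [show W (t, 0) = w t 0 from rfl, h0, norm_zero]
    linarith
  · -- `𝐈 < ∞` for the limit
    have hunif : ∀ N : ℕ, TendstoUniformlyOn (fun j => uncurry (U (φ j))) (uncurry w) atTop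
        (parCyl 0 ((N : ℝ) + 1)) := fun N => by
      rw [hwW]
      exact (hunifT N).mono (parCyl_subset_closedTop _)
    have hNSN : ∀ N : ℕ, ∀ᶠ k in atTop,
        IsDistributionalNSSolutionOn (parCylOpens 0 ((N : ℝ) + 1)) 1 0 (U k) (Pq k) := fun N =>
      hNSR _ (by positivity)
    have hDP : ∀ r : ℝ, 0 < r → ∀ z : ℝ × EuclideanSpace ℝ (Fin 3), z.1 ≤ 0 → cknDOsc r z P ≤ I₀ :=
      cknDOsc_limit_le hφ hcontU hbU hunif (Eventually.of_forall hPc) hNSN hD hI0 hclP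
    have hfin : (K : ℝ≥0∞) + I₀ + I₀ + I₀ < ⊤ :=
      ENNReal.add_lt_top.2 ⟨ENNReal.add_lt_top.2 ⟨ENNReal.add_lt_top.2 ⟨ENNReal.coe_lt_top, hI⟩,
        hI⟩, hI⟩
    refine lt_of_le_of_lt (iSup₂_le fun r hr => iSup₂_le fun z hzsub => ?_) hfin
    have hz0 : z.1 ≤ 0 := fst_nonpos_of_parabolicCylinder_subset hr hzsub
    have hA : cknA r z w ≤ K := by
      refine iSup₂_le fun t ht => ?_
      have ht0 : t ≤ 0 := (ht.2.trans_le hz0).le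
      calc (ENNReal.ofReal r)⁻¹ * ∫⁻ x in ball z.2 r, ‖w t x‖ₑ ^ 2
          ≤ ∫⁻ x in ball z.2 r, ‖w t x‖ₑ ^ 2 / ‖x - z.2‖ₑ :=
            inv_mul_lintegral_ball_le_lintegral_div (w t) z.2 hr
        _ ≤ ∫⁻ x, ‖w t x‖ₑ ^ 2 / ‖x - z.2‖ₑ := setLIntegral_le_lintegral _ _
        _ ≤ K := hHW t ht0 z.2
    have hC : cknC r z w ≤ I₀ :=
      cknC_limit_le hU hzc hc0 hc1 (fun ρ hρ z' hz' => (hcomp ρ hρ z' hz').1) hcontU hφ hpt hr hz0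
    have hDb := hDP r hr z hz0
    unfold cknDOsc at hDb
    have hE : cknE r z (fun t x => fderiv ℝ (w t) x) ≤ I₀ :=
      cknE_limit_le hcl₁.smooth_velocity hU hzc hc0 hc1 (fun ρ hρ z' hz' => (hcomp ρ hρ z' hz').2.2)
        hcontU hbU hNS' hφ hpt hr hz0
    exact add_le_add (add_le_add (add_le_add hA hC) hDb) hE

end HardyAncientLimit

end Summit.NavierStokesRegularity.NavierStokesRegularity.Theorems

end
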